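import Literature.RingTheory.HilbertSamuel.PhiUpperBound
import Literature.RingTheory.HilbertSamuel.LocalizedPolynomialProofs
import Literature.RingTheory.KrullDimension.AffineDimension
import Literature.RingTheory.MvPolynomial.HomogeneousDimension
import Literature.RingTheory.MvPolynomial.HomogeneousHilbertFunction
import Literature.RingTheory.MvPolynomial.HilbertFunctionBounds
import Literature.RingTheory.MvPolynomial.HilbertPolynomialDegree
import Literature.RingTheory.MvPolynomial.HilbertPolynomialExists
import HarnessLib

/-!
# `dim C(𝒪) = dim 𝒪`: the dimension of the tangent cone, CJS Lemma 2.14 (b), (c) for local rings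

Topic: `Literature/RingTheory/HilbertSamuel`. Cossart–Jannsen–Saito (LNM 2270), Ch. 2, p. 26:
"We note that `dim C(𝒪) = dim 𝒪`" for the tangent cone `C(𝒪) = Spec(gr_𝔫(𝒪))` of a noetherian
local ring — Matsumura, *Commutative Ring Theory*, Thm. 13.9: "Let `(A, 𝔪, k)` be a Noetherian
local ring, and set `G = gr_𝔪 A`; then `dim A = dim G`" — the input of CJS Lemma 2.20 (1)
(`e(R/J) ≤ dim(R/J)`) and of the proof of Lemma 2.23 ("Since `dim(𝒪) = dim(gr_𝔪 𝒪)` … this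
follows from Lemma 2.14").

In this topic `gr_𝔪(A)` is presented degreewise as `k[X_1, …, X_e]/J`, `J = tangentConeIdeal x hx`
the homogeneous ideal of relations among the symbols of generators `x_1, …, x_e` of `𝔪`
(`TangentConeIdeal.lean`: `H(k[X]/J) = H^{(0)}_A`). We prove:

* **`ringKrullDim_quotient_eq_of_noether`** — graded Noether normalisation computes the dimension:
  if `y_1, …, y_r` are linear forms, algebraically independent modulo a homogeneous ideal `J`, with
  `S_{≥ m} ⊆ (y) + J` (`CoversDegrees`), then `S/J` is a finite `K[Y_1, …, Y_r]`-module (generated by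
  the monomials of degree `< m`) containing `K[Y]`, so `dim S/J = r`
  (`Literature.RingTheory.KrullDimension.ringKrullDim_eq_of_isIntegral`);
* **`eq_dim_of_noether_tangentConeIdeal`** — for `J` the tangent cone ideal of `A`, necessarily
  `r = dim A`: `dim A ≤ r` is `ringKrullDim_le_of_coversDegrees` (`PhiLowerBound.lean`, Krull), and
  `Φ^{(r)} ≤ H(S/J) = H^{(0)}_A` forces `r ≤ dim A` by CJS Lemma 2.25 (a) (`PhiUpperBound.lean`);
* **`ringKrullDim_quotient_tangentConeIdeal_le`** — `dim k[X]/J ≤ dim A` for EVERY noetherian local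
  ring (a top-dimensional minimal prime `𝔭 ⊇ J` has `binom(t+b, b) ≤ H(S/𝔭; t) ≤ H(S/J; t)`,
  `Literature.RingTheory.MvPolynomial.choose_le_hilbert_of_isPrime`, and Lemma 2.25 (a) again);
* **`ringKrullDim_quotient_tangentConeIdeal`** — **`dim k[X]/J = dim A`** when the residue field is
  infinite (where graded Noether normalisation is available; the general case reduces to this one
  through `A(X) = A[X]_{𝔪A[X]}`, but needs `gr_𝔪(A(X)) = gr_𝔪(A) ⊗_k k(X)`, not done here);
* **`exists_hilbertFun_le_smul`** — CJS Lemma 2.14 (b) for local rings of dimension `d ≥ 1`: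
  `H^{(0)}_A ≤ M Φ^{(d)}` for some integer `M ≥ 1` (all noetherian local rings, via `A(X)` and
  `Literature.RingTheory.MvPolynomial.hilbert_le_mul_pow`; for `d = 0` the printed bound fails, see
  `PhiUpperBound.lean`);
* **`exists_hilbertPolynomial_hilbertFun`** — the Hilbert polynomial of a noetherian local ring of
  dimension `d ≥ 1`: `H^{(0)}_A(t) = P(t)` for `t ≫ 0` with `deg P = d - 1` and leading coefficient
  `≥ 1/(d-1)!` (Matsumura Thm. 13.4, `dim A = d(A)`; the "different asymptotics" behind CJS
  Lemma 2.14 (c)), from `Literature.RingTheory.MvPolynomial.natDegree_hilbertPolynomial`;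
  `hilbertFun_eventually_zero_of_ringKrullDim_eq_zero` — for `d = 0`, `H^{(0)}_A(t) = 0` for `t ≫ 0`.

## References

* V. Cossart, U. Jannsen, S. Saito, *Desingularization: Invariants and Strategy*, LNM 2270
  (2020), Ch. 2, p. 26 (`dim C(𝒪) = dim 𝒪`), Lemma 2.14 (b), (c), Lemma 2.23. [CossartJannsenSaito2020]
* H. Matsumura, *Commutative Ring Theory* (1986), Thm. 13.4, Thm. 13.9. [Matsumura1987]
-/

noncomputable section

open IsLocalRing Finset MvPolynomial
open Literature.RingTheory.MvPolynomial Literature.RingTheory.KrullDimension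

namespace Literature.RingTheory.HilbertSamuel

universe u

/-! ## Graded Noether normalisation computes the dimension -/

section Noether

variable {K : Type*} [Field K] {e : ℕ}

/-- **`dim S/J = r` from a graded Noether normalisation**: if `y_1, …, y_r ∈ S = K[X_1, …, X_e]`
are linear forms with `S_n ⊆ (y) + J` for `n ≥ m ≥ 1` and `K[Y] → S/J`, `Y_i ↦ y_i`, injective, then
`S/J` is finite over `K[Y_1, …, Y_r]` (generated by the monomials of degree `< m`), hence
`dim S/J = dim K[Y] = r`. (CJS, proof of Lemma 2.14 (a): "a Noether normalization
`i : k[X_1, …, X_d] ↪ A` such that the `X_i` are mapped to `A_1` … a monomorphism of graded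
`k`-algebras", with `A` finite over it.) [cite: CossartJannsenSaito2020, Lemma 2.14 (a) (proof)] -/
theorem ringKrullDim_quotient_eq_of_noether {J : Ideal (MvPolynomial (Fin e) K)}
    (hJ : IsHomogeneousIdeal J) {r : ℕ} {y : Fin r → MvPolynomial (Fin e) K}
    (hy : ∀ i, (y i).IsHomogeneous 1) {m : ℕ} (hm : 1 ≤ m)
    (hcov : CoversDegrees (Ideal.span (Set.range y) ⊔ J) m)
    (hinj : ∀ F : MvPolynomial (Fin r) K, aeval y F ∈ J → F = 0) :
    ringKrullDim (MvPolynomial (Fin e) K ⧸ J) = r := by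
  classical
  -- `K[Y_1, …, Y_r]` acts on `S/J` through `Y_i ↦ y_i`
  let φ : MvPolynomial (Fin r) K →ₐ[K] MvPolynomial (Fin e) K ⧸ J :=
    (Ideal.Quotient.mkₐ K J).comp (aeval y)
  letI alg : Algebra (MvPolynomial (Fin r) K) (MvPolynomial (Fin e) K ⧸ J) :=
    φ.toRingHom.toAlgebra
  have hsmul : ∀ (p : MvPolynomial (Fin r) K) (v : MvPolynomial (Fin e) K ⧸ J),
      p • v = φ p * v := fun p v => Algebra.smul_def p v
  have hφX : ∀ i, φ (X i) = Ideal.Quotient.mk J (y i) := fun i => by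
    show Ideal.Quotient.mkₐ K J (aeval y (X i)) = _
    rw [aeval_X]
    rfl
  have hφC : ∀ c : K, φ (C c) = Ideal.Quotient.mk J (C c) := fun c => by
    show Ideal.Quotient.mkₐ K J (aeval y (C c)) = _
    rw [aeval_C]
    rfl
  -- the candidate module generators: the monomials of degree `< m`
  let B : Finset (MvPolynomial (Fin e) K ⧸ J) := ((Finset.range m).biUnion fun j =>
      (Finset.univ : Finset (Fin e)).finsuppAntidiag j).image
    fun s => Ideal.Quotient.mk J (monomial s (1 : K))
  let N : Submodule (MvPolynomial (Fin r) K) (MvPolynomial (Fin e) K ⧸ J) :=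
    Submodule.span _ (B : Set (MvPolynomial (Fin e) K ⧸ J))
  have hB : ∀ s : Fin e →₀ ℕ, s.degree < m → Ideal.Quotient.mk J (monomial s (1 : K)) ∈ N := by
    intro s hs
    apply Submodule.subset_span
    simp only [B, Finset.coe_image, Finset.coe_biUnion, Finset.coe_range, Set.mem_image,
      Set.mem_iUnion, Set.mem_Iio, Finset.mem_coe, Finset.mem_finsuppAntidiag]
    exact ⟨s, ⟨s.degree, hs, (Finsupp.degree_eq_sum s).symm, Finset.subset_univ _⟩, rfl⟩
  have hCsmul : ∀ (a : K) (w : MvPolynomial (Fin e) K ⧸ J), w ∈ N →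
      Ideal.Quotient.mk J (C a) * w ∈ N := by
    intro a w hw
    rw [← hφC, ← hsmul]
    exact N.smul_mem _ hw
  -- every form of degree `n` lies in `N` (strong induction on `n`)
  have key : ∀ (n : ℕ) (f : MvPolynomial (Fin e) K), f.IsHomogeneous n →
      Ideal.Quotient.mk J f ∈ N := by
    intro n
    induction n using Nat.strong_induction_on with
    | _ n ih =>
    intro f hf
    by_cases hn : n < m
    · rw [f.as_sum, map_sum]
      refine Submodule.sum_mem _ fun s hs => ?_
      have hsdeg : s.degree = n := by
        by_contra hne
        exact (mem_support_iff.mp hs) (hf.coeff_eq_zero hne)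
      rw [show monomial s (coeff s f) = C (coeff s f) * monomial s (1 : K) by
        rw [C_mul_monomial, mul_one], map_mul]
      exact hCsmul _ _ (hB s (hsdeg ▸ hn))
    · obtain ⟨n', rfl⟩ : ∃ n', n = n' + 1 := ⟨n - 1, by omega⟩
      obtain ⟨g, hg, j, hj, hgj⟩ := Submodule.mem_sup.mp (hcov (n' + 1) (not_lt.mp hn) f hf)
      obtain ⟨c, hc⟩ := Ideal.mem_span_range_iff_exists_fun.mp hg
      have hfdec : f = ∑ i, y i * homogeneousComponent n' (c i) +
          homogeneousComponent (n' + 1) j := by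
        conv_lhs => rw [← homogeneousComponent_eq_self hf, ← hgj, ← hc, map_add, map_sum]
        congr 1
        refine Finset.sum_congr rfl fun i _ => ?_
        rw [mul_comm (c i), homogeneousComponent_mul_add_of_isHomogeneous (hy i)]
      rw [hfdec, map_add, map_sum]
      refine Submodule.add_mem _ (Submodule.sum_mem _ fun i _ => ?_) ?_
      · rw [map_mul, ← hφX, ← hsmul]
        exact N.smul_mem _
          (ih n' (Nat.lt_succ_self n') _ (homogeneousComponent_isHomogeneous n' (c i)))
      · rw [Ideal.Quotient.eq_zero_iff_mem.mpr (hJ j hj (n' + 1))]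
        exact N.zero_mem
  -- hence `N = S/J`: `S/J` is finite, so integral, over `K[Y]`, and contains it
  have hN : N = ⊤ := by
    rw [eq_top_iff]
    rintro v -
    obtain ⟨f, rfl⟩ := Ideal.Quotient.mk_surjective v
    rw [← sum_homogeneousComponent f, map_sum]
    exact Submodule.sum_mem _ fun i _ => key i _ (homogeneousComponent_isHomogeneous i f)
  haveI : Module.Finite (MvPolynomial (Fin r) K) (MvPolynomial (Fin e) K ⧸ J) := ⟨⟨B, hN⟩⟩
  haveI : Algebra.IsIntegral (MvPolynomial (Fin r) K) (MvPolynomial (Fin e) K ⧸ J) :=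
    Algebra.IsIntegral.of_finite _ _
  have hinj' : Function.Injective
      (algebraMap (MvPolynomial (Fin r) K) (MvPolynomial (Fin e) K ⧸ J)) := by
    rw [injective_iff_map_eq_zero]
    intro F hF
    have hF' : Ideal.Quotient.mk J (aeval y F) = 0 := hF
    exact hinj F (Ideal.Quotient.eq_zero_iff_mem.mp hF')
  rw [← ringKrullDim_eq_of_isIntegral hinj', ringKrullDim_mvPolynomial_fin]

end Noether

/-! ## The tangent cone of a noetherian local ring -/

section Local

variable {A : Type u} [CommRing A] [IsLocalRing A] [IsNoetherianRing A] {e : ℕ} (x : Fin e → A)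
  (hx : Ideal.span (Set.range x) = maximalIdeal A)

/-- **`r = dim A` in any graded Noether normalisation of the tangent cone**: for
`J = tangentConeIdeal x hx` and linear forms `y_1, …, y_r` algebraically independent modulo `J`
with `S_{≥ m} ⊆ (y) + J`, `r = dim A` — `dim A ≤ r` by Krull (`ringKrullDim_le_of_coversDegrees`),
`r ≤ dim A` because `Φ^{(r)} ≤ H(S/J) = H^{(0)}_A` (CJS Lemma 2.25 (a)).
[cite: CossartJannsenSaito2020, Lemma 2.23 (proof)] -/
theorem eq_dim_of_noether_tangentConeIdeal {d : ℕ} (hd : ringKrullDim A = d) {r : ℕ}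
    {y : Fin r → MvPolynomial (Fin e) (ResidueField A)} (hy : ∀ i, (y i).IsHomogeneous 1)
    {m : ℕ} (hm : 1 ≤ m)
    (hcov : CoversDegrees (Ideal.span (Set.range y) ⊔ tangentConeIdeal x hx) m)
    (hinj : ∀ F : MvPolynomial (Fin r) (ResidueField A), aeval y F ∈ tangentConeIdeal x hx → F = 0) :
    r = d := by
  apply le_antisymm
  · have h1 : iterPSum r Phi ≤ hilbertFun A := by
      rw [← hilbertFunQuot_tangentConeIdeal x hx]
      exact iterPSum_Phi_le_hilbertFunQuot hy hinj
    exact (le_dim_iff_iterPSum_Phi_le A hd r 0).mpr (by simpa using h1)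
  · have h2 := ringKrullDim_le_of_coversDegrees x hx hy hm hcov
    rw [hd] at h2
    exact_mod_cast h2

/-- **`dim C(𝒪) ≤ dim 𝒪`** for every noetherian local ring: `dim k[X_1, …, X_e]/J ≤ dim A` for
the tangent cone ideal `J` (if `dim S/J = b + 1`, a minimal prime `𝔭 ⊇ J` with `dim S/𝔭 = b + 1`
gives `Φ^{(b+1)}(t) = binom(t+b, b) ≤ H(S/𝔭; t) ≤ H(S/J; t) = H^{(0)}_A(t)`, and CJS Lemma 2.25 (a)
yields `b + 1 ≤ dim A`). [cite: Matsumura1987, Thm. 13.9] -/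
theorem ringKrullDim_quotient_tangentConeIdeal_le :
    ringKrullDim (MvPolynomial (Fin e) (ResidueField A) ⧸ tangentConeIdeal x hx) ≤
      ringKrullDim A := by
  obtain ⟨d, hd⟩ : ∃ d : ℕ, ringKrullDim A = d :=
    exists_nat_eq_of_ne_bot_of_ne_top ringKrullDim_ne_bot ringKrullDim_ne_top
  haveI : Nontrivial (MvPolynomial (Fin e) (ResidueField A) ⧸ tangentConeIdeal x hx) :=
    Ideal.Quotient.nontrivial_iff.mpr (tangentConeIdeal_ne_top x hx)
  obtain ⟨n, hn⟩ : ∃ n : ℕ,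
      ringKrullDim (MvPolynomial (Fin e) (ResidueField A) ⧸ tangentConeIdeal x hx) = n := by
    refine exists_nat_eq_of_ne_bot_of_ne_top ?_ ?_
    · exact ne_bot_of_le_ne_bot WithBot.zero_ne_bot ringKrullDim_nonneg_of_nontrivial
    · refine ne_top_of_le_ne_top ?_ (ringKrullDim_quotient_le _)
      rw [ringKrullDim_mvPolynomial_fin]
      intro h
      exact ENat.coe_ne_top e (WithBot.coe_eq_top.mp ((WithBot.coe_natCast e).trans h))
  rw [hn, hd]
  cases n with
  | zero => exact_mod_cast Nat.zero_le d
  | succ b =>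
    obtain ⟨𝔭, h𝔭, h𝔭dim⟩ := exists_minimalPrimes_ringKrullDim_quotient_eq hn
    haveI : 𝔭.IsPrime := h𝔭.1.1
    have hle : iterPSum (b + 1) Phi ≤ hilbertFun A := fun t => by
      rw [iterPSum_succ_Phi_eq_choose, ← hilbertFunQuot_tangentConeIdeal x hx]
      exact (choose_le_hilbert_of_isPrime h𝔭dim t).trans (hilbert_antitone h𝔭.1.2 t)
    exact_mod_cast (le_dim_iff_iterPSum_Phi_le A hd (b + 1) 0).mpr (by simpa using hle)

/-- **`dim C(𝒪) = dim 𝒪`** (CJS p. 26; Matsumura Thm. 13.9 `dim A = dim gr_𝔪 A`) for a noetherian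
local ring with infinite residue field: `dim k[X_1, …, X_e]/J = dim A` for the tangent cone ideal
`J` (`k[X]/J ≅ gr_𝔪(A)` degreewise). [cite: Matsumura1987, Thm. 13.9] -/
theorem ringKrullDim_quotient_tangentConeIdeal [Infinite (ResidueField A)] :
    ringKrullDim (MvPolynomial (Fin e) (ResidueField A) ⧸ tangentConeIdeal x hx) =
      ringKrullDim A := by
  obtain ⟨d, hd⟩ : ∃ d : ℕ, ringKrullDim A = d :=
    exists_nat_eq_of_ne_bot_of_ne_top ringKrullDim_ne_bot ringKrullDim_ne_top
  obtain ⟨r, y, hy, ⟨m, hm, hcov⟩, hinj⟩ :=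
    exists_linear_noether (isHomogeneousIdeal_tangentConeIdeal x hx) (tangentConeIdeal_ne_top x hx)
  have hr : r = d := eq_dim_of_noether_tangentConeIdeal x hx hd hy hm hcov hinj
  rw [ringKrullDim_quotient_eq_of_noether (isHomogeneousIdeal_tangentConeIdeal x hx) hy hm hcov hinj,
    hr, hd]

/-! ## CJS Lemma 2.14 (b) for local rings and the Hilbert polynomial -/

/-- `(t+1)^b ≤ b! · binom(t+b, b) = b! · Φ^{(b+1)}(t)` (`(t+1)(t+2)⋯(t+b) ≥ (t+1)^b`). [folklore] -/
theorem pow_le_factorial_mul_iterPSum_Phi (b t : ℕ) :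
    (t + 1) ^ b ≤ b.factorial * iterPSum (b + 1) Phi t := by
  rw [iterPSum_succ_Phi_eq_choose, ← Nat.ascFactorial_eq_factorial_mul_choose]
  exact Nat.pow_succ_le_ascFactorial (t + 1) b

omit x in
/-- **CJS Lemma 2.14 (b) for a local ring with infinite residue field**: if `dim A = d ≥ 1` then
`H^{(0)}_A ≤ M · Φ^{(d)}` for some integer `M ≥ 1` (`H^{(0)}_A = H(k[X]/J)` with `dim k[X]/J = d`,
so `H^{(0)}_A(t) ≤ C (t+1)^{d-1} ≤ C (d-1)! Φ^{(d)}(t)`). [cite: CossartJannsenSaito2020, Lemma 2.14 (b)] -/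
theorem exists_hilbertFun_le_smul_of_infinite [Infinite (ResidueField A)] {d : ℕ}
    (hd : ringKrullDim A = d) (hd1 : 1 ≤ d) :
    ∃ M : ℕ, 1 ≤ M ∧ hilbertFun A ≤ M • iterPSum d Phi := by
  obtain ⟨x, hx⟩ := exists_span_range_eq_maximalIdeal A (le_refl (maximalIdeal A).spanFinrank)
  obtain ⟨b, rfl⟩ : ∃ b, d = b + 1 := ⟨d - 1, by omega⟩
  have hdim : ringKrullDim (MvPolynomial (Fin _) (ResidueField A) ⧸ tangentConeIdeal x hx) ≤
      (b + 1 : ℕ) := by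
    rw [ringKrullDim_quotient_tangentConeIdeal x hx, hd]
  obtain ⟨C, hC⟩ := hilbert_le_mul_pow b (tangentConeIdeal x hx)
    ((isHomogeneousIdeal_iff _).mp (isHomogeneousIdeal_tangentConeIdeal x hx)) hdim
  refine ⟨C * b.factorial + 1, Nat.succ_le_succ (Nat.zero_le _), fun t => ?_⟩
  rw [Pi.smul_apply, smul_eq_mul, ← hilbertFunQuot_tangentConeIdeal x hx]
  calc hilbertFunQuot (ResidueField A) _ (tangentConeIdeal x hx) t ≤ C * (t + 1) ^ b := hC t
    _ ≤ C * (b.factorial * iterPSum (b + 1) Phi t) :=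
        Nat.mul_le_mul_left C (pow_le_factorial_mul_iterPSum_Phi b t)
    _ = C * b.factorial * iterPSum (b + 1) Phi t := (mul_assoc _ _ _).symm
    _ ≤ (C * b.factorial + 1) * iterPSum (b + 1) Phi t :=
        Nat.mul_le_mul_right _ (Nat.le_succ _)

omit x in
/-- **CJS Lemma 2.14 (b) for noetherian local rings of dimension `d ≥ 1`**: "for a suitable
integer `m ≥ 1` one has `mΦ^{(d)} ≥ H^{(0)}`" (reduction to an infinite residue field through
`A(X) = A[X]_{𝔪A[X]}`, which has the same Hilbert function and dimension). For `d = 0` the statement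
is false unless `A` is a field; the replacement valid in all dimensions is
`exists_hilbertSamuelFun_one_le_smul`. [cite: CossartJannsenSaito2020, Lemma 2.14 (b)] -/
theorem exists_hilbertFun_le_smul {d : ℕ} (hd : ringKrullDim A = d) (hd1 : 1 ≤ d) :
    ∃ M : ℕ, 1 ≤ M ∧ hilbertFun A ≤ M • iterPSum d Phi := by
  haveI := infinite_residueField_localizedPolynomial A
  have hd' : ringKrullDim (LocalizedPolynomial A) = d := by
    rw [ringKrullDim_localizedPolynomial, hd]
  obtain ⟨M, hM, h⟩ := exists_hilbertFun_le_smul_of_infinite hd' hd1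
  exact ⟨M, hM, by rwa [hilbertFun_localizedPolynomial] at h⟩

omit x in
/-- **`H^{(t)}_A ≤ M · Φ^{(t+d)}`** for `d = dim A ≥ 1` and all `t`. [cite: CossartJannsenSaito2020, Lemma 2.14 (b)] -/
theorem exists_hilbertSamuelFun_le_smul {d : ℕ} (hd : ringKrullDim A = d) (hd1 : 1 ≤ d) (t : ℕ) :
    ∃ M : ℕ, 1 ≤ M ∧ hilbertSamuelFun A t ≤ M • iterPSum (t + d) Phi := by
  obtain ⟨M, hM, h⟩ := exists_hilbertFun_le_smul hd hd1
  refine ⟨M, hM, ?_⟩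
  rw [hilbertSamuelFun, iterPSum_add, ← iterPSum_smul]
  exact iterPSum_mono t h

omit x in
/-- **The Hilbert polynomial of a noetherian local ring** (Matsumura Thm. 13.4 `dim A = d(A)`;
Hilbert–Samuel): if `dim A = d ≥ 1` there is `P ∈ ℚ[T]` of degree exactly `d - 1`, with leading
coefficient `≥ 1/(d-1)!`, such that `H^{(0)}_A(t) = dim_k 𝔪ᵗ/𝔪ᵗ⁺¹ = P(t)` for all large `t`
(the "different asymptotics for `N ≠ d`" of CJS Lemma 2.14 (c)). [cite: Matsumura1987, Thm. 13.4] -/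
theorem exists_hilbertPolynomial_hilbertFun {d : ℕ} (hd : ringKrullDim A = d) (hd1 : 1 ≤ d) :
    ∃ (P : Polynomial ℚ) (t₀ : ℕ), (∀ t, t₀ ≤ t → (hilbertFun A t : ℚ) = P.eval (t : ℚ)) ∧
      P.natDegree = d - 1 ∧ (((d - 1).factorial : ℕ) : ℚ)⁻¹ ≤ P.leadingCoeff := by
  -- pass to `B = A(X)`: same Hilbert function and dimension, infinite residue field
  haveI := infinite_residueField_localizedPolynomial A
  set B := LocalizedPolynomial A
  have hdB : ringKrullDim B = d := by rw [ringKrullDim_localizedPolynomial, hd]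
  obtain ⟨x, hx⟩ := exists_span_range_eq_maximalIdeal B (le_refl (maximalIdeal B).spanFinrank)
  obtain ⟨b, rfl⟩ : ∃ b, d = b + 1 := ⟨d - 1, by omega⟩
  have hJ := (isHomogeneousIdeal_iff _).mp (isHomogeneousIdeal_tangentConeIdeal x hx)
  have hdim : ringKrullDim (MvPolynomial (Fin _) (ResidueField B) ⧸ tangentConeIdeal x hx) =
      (b + 1 : ℕ) := by
    rw [ringKrullDim_quotient_tangentConeIdeal x hx, hdB]
  obtain ⟨P, t₀, hP⟩ := exists_hilbertPolynomial (tangentConeIdeal x hx) hJ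
  obtain ⟨hdeg, hlc⟩ := natDegree_hilbertPolynomial hJ hdim hP
  refine ⟨P, t₀, fun t ht => ?_, by simpa using hdeg, by simpa using hlc⟩
  rw [← hP t ht, ← hilbertFun_localizedPolynomial A]
  exact congrArg (fun n : ℕ => (n : ℚ)) (congrFun (hilbertFunQuot_tangentConeIdeal x hx) t).symm

omit x in
/-- For `dim A = 0` the Hilbert function vanishes eventually: `A` is Artinian, `𝔪ᵗ = 0` for
`t ≫ 0`. [folklore] -/
theorem hilbertFun_eventually_zero_of_ringKrullDim_eq_zero (hd : ringKrullDim A = 0) :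
    ∃ t₀ : ℕ, ∀ t, t₀ ≤ t → hilbertFun A t = 0 := by
  haveI : Ring.KrullDimLE 0 A := Ring.krullDimLE_iff.mpr (by rw [hd]; rfl)
  haveI : IsArtinianRing A := IsNoetherianRing.isArtinianRing_of_krullDimLE_zero
  obtain ⟨N, hN⟩ := IsArtinianRing.isNilpotent_jacobson_bot (R := A)
  rw [IsLocalRing.jacobson_eq_maximalIdeal ⊥ bot_ne_top] at hN
  refine ⟨N, fun t ht => ?_⟩
  have hzero : maximalIdeal A ^ t = ⊥ := by
    rw [eq_bot_iff, ← Ideal.zero_eq_bot, ← hN]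
    exact Ideal.pow_le_pow_right ht
  haveI : Subsingleton ↥(maximalIdeal A ^ t) := by
    rw [hzero]
    infer_instance
  haveI : Subsingleton (gradedPiece (maximalIdeal A) t) := ⟨fun a b => by
    obtain ⟨a', rfl⟩ := gradedPiece.mk_surjective _ t a
    obtain ⟨b', rfl⟩ := gradedPiece.mk_surjective _ t b
    rw [Subsingleton.elim a' b']⟩
  exact Module.finrank_zero_of_subsingleton

end Local

end Literature.RingTheory.HilbertSamuel

end
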